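import Literature.Analysis.Calculus.WhitneyExtension
import Literature.Analysis.Calculus.WhitneyConvexExtension
import Mathlib.Geometry.Manifold.PartitionOfUnity
import Mathlib.MeasureTheory.Measure.Haar.InnerProductSpace
import HarnessLib

/-!
# Discharge of `WhitneyExtensionConvex` (Whitney (1934), Thm. I, on closed convex sets)

`Literature.Analysis.Calculus.WhitneyExtensionConvex` (`WhitneyExtension.lean`) — a real
function of class `C^∞` in the within sense on a closed convex `K ⊆ ℝⁿ` with nonempty
interior is the restriction of a `C^∞` function on `ℝⁿ` (Whitney (1934), Thm. I, `m` infinite,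
with §3) — is **proved** here (`Literature.Analysis.Calculus.WhitneyExtensionConvex_holds`),
from the compact case `Literature.Analysis.Calculus.WhitneyConvex.exists_contDiff_extension`
(`WhitneyConvexExtension.lean`: the dilation–extrapolation operator of
`WhitneyConvexWeights/Partition/Dilation/Operator.lean`, glued by `WhitneyConvexGluing.lean`)
by localization and a smooth partition of unity: near `x₀ ∈ K` the compact convex body
`K ∩ closedBall x₀ 2` contains a ball of the interior of `K` inside `ball x₀ 1`, and its
`C^∞` extension agrees with `f` on `K ∩ ball x₀ 1`; Mathlib's
`exists_contMDiffMap_forall_mem_convex_of_local` patches these local extensions (and `0` off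
`K`) into a global one.

Consequently the isotopy extension theorem for compact sources over an arbitrary model with
corners (`Literature/Topology/FourManifolds/IsotopyExtensionCorners.lean`, stated modulo this
fact) holds unconditionally; see there.

## References

* H. Whitney, *Analytic extensions of differentiable functions defined in closed sets*, Trans.
  Amer. Math. Soc. 36 (1934), 63–89, Thm. I, §3, §§11–12. [Whitney1934]
-/

open Set Metric Filter Function
open scoped ContDiff Topology Manifold

noncomputable section

namespace Literature.Analysis.Calculus

open WhitneyConvex

/-- **Local extensions near a point of `K`**: for `K` closed convex with nonempty interior in
`ℝⁿ`, `f` of class `C^∞` on `K`, and `x₀ ∈ K`, there is a `C^∞` function on `ℝⁿ` equal to `f`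
on `K ∩ ball x₀ 1` (the compact case applied to `K ∩ closedBall x₀ 2`, which contains a closed
ball about an interior point of `K` within `ball x₀ 1`). [cite: Whitney1934, Thm. I] -/
theorem WhitneyExtensionConvex.exists_local {n : ℕ} {K : Set (EuclideanSpace ℝ (Fin n))}
    (hK : IsClosed K) (hKc : Convex ℝ K) (hKi : (interior K).Nonempty)
    {f : EuclideanSpace ℝ (Fin n) → ℝ} (hf : ContDiffOn ℝ ∞ f K) {x₀ : EuclideanSpace ℝ (Fin n)}
    (hx₀ : x₀ ∈ K) :
    ∃ g : EuclideanSpace ℝ (Fin n) → ℝ, ContDiff ℝ ∞ g ∧ EqOn g f (K ∩ ball x₀ 1) := by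
  -- an interior point of `K` near `x₀`, with a closed ball
  have hx₀' : x₀ ∈ closure (interior K) := by
    rw [hKc.closure_interior_eq_closure_of_nonempty_interior hKi]
    exact subset_closure hx₀
  obtain ⟨c, hc⟩ := mem_closure_iff_nhds.1 hx₀' (ball x₀ 1) (ball_mem_nhds x₀ one_pos)
  obtain ⟨hcb, hci⟩ := hc
  have hopen : IsOpen (interior K ∩ ball x₀ 1) := isOpen_interior.inter isOpen_ball
  obtain ⟨r, hr, hball⟩ := Metric.isOpen_iff.1 hopen c ⟨hci, hcb⟩
  -- the compact convex body
  set K₀ : Set (EuclideanSpace ℝ (Fin n)) := K ∩ closedBall x₀ 2 with hK₀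
  have hK₀c : IsCompact K₀ := (isCompact_closedBall x₀ 2).of_isClosed_subset
    (hK.inter isClosed_closedBall) inter_subset_right
  have hK₀conv : Convex ℝ K₀ := hKc.inter (convex_closedBall x₀ 2)
  have hballK₀ : closedBall c (r / 2) ⊆ K₀ := by
    intro y hy
    have hy' : y ∈ ball c r := closedBall_subset_ball (half_lt_self hr) hy
    obtain ⟨hyi, hyb⟩ := hball hy'
    exact ⟨interior_subset hyi, (ball_subset_closedBall.trans
      (closedBall_subset_closedBall (by norm_num))) hyb⟩
  obtain ⟨g, hg, hgf⟩ := exists_contDiff_extension (F := ℝ) hK₀conv hK₀c hballK₀ (half_pos hr)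
    (hf.mono inter_subset_left)
  refine ⟨g, hg, fun y hy => hgf ⟨hy.1, ?_⟩⟩
  exact (ball_subset_closedBall.trans (closedBall_subset_closedBall (by norm_num))) hy.2

/-- **Whitney's extension theorem on closed convex sets with nonempty interior holds**: the
named fact `Literature.Analysis.Calculus.WhitneyExtensionConvex` (Whitney (1934), Thm. I, `m`
infinite, with §3), proved by the dilation–extrapolation operator on compact convex bodies
(`WhitneyConvex.exists_contDiff_extension`), localization (`exists_local`) and a smooth
partition of unity (`exists_contMDiffMap_forall_mem_convex_of_local`).
[cite: Whitney1934, Thm. I (p. 65) with §3] -/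
theorem WhitneyExtensionConvex_holds : WhitneyExtensionConvex := by
  classical
  intro n K hK hKc hKi f hf
  -- the convex constraint: `g x = f x` on `K`
  let t : EuclideanSpace ℝ (Fin n) → Set ℝ := fun x => if x ∈ K then {f x} else univ
  have ht_mem : ∀ x, x ∈ K → t x = {f x} := fun x hx => if_pos hx
  have ht_not : ∀ x, x ∉ K → t x = univ := fun x hx => if_neg hx
  have htc : ∀ x, Convex ℝ (t x) := fun x => by
    by_cases hx : x ∈ K
    · rw [ht_mem x hx]; exact convex_singleton _
    · rw [ht_not x hx]; exact convex_univ
  have hloc : ∀ x : EuclideanSpace ℝ (Fin n), ∃ U ∈ 𝓝 x, ∃ g : EuclideanSpace ℝ (Fin n) → ℝ,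
      ContMDiffOn 𝓘(ℝ, EuclideanSpace ℝ (Fin n)) 𝓘(ℝ, ℝ) ∞ g U ∧ ∀ y ∈ U, g y ∈ t y := by
    intro x
    by_cases hx : x ∈ K
    · obtain ⟨g, hg, hgf⟩ := WhitneyExtensionConvex.exists_local hK hKc hKi hf hx
      refine ⟨ball x 1, ball_mem_nhds x one_pos, g, (contMDiff_iff_contDiff.2 hg).contMDiffOn,
        fun y hy => ?_⟩
      by_cases hyK : y ∈ K
      · rw [ht_mem y hyK, mem_singleton_iff]; exact hgf ⟨hyK, hy⟩
      · rw [ht_not y hyK]; exact mem_univ _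
    · refine ⟨Kᶜ, hK.isOpen_compl.mem_nhds hx, fun _ => 0, contMDiffOn_const, fun y hy => ?_⟩
      rw [ht_not y hy]; exact mem_univ _
  obtain ⟨g, hg⟩ := exists_contMDiffMap_forall_mem_convex_of_local 𝓘(ℝ, EuclideanSpace ℝ (Fin n))
    htc hloc
  refine ⟨g, contMDiff_iff_contDiff.1 g.contMDiff, fun x hx => ?_⟩
  have := hg x
  rw [ht_mem x hx, mem_singleton_iff] at this
  exact this

end Literature.Analysis.Calculus
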